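import Literature.NumberTheory.EllipticCurves.LatticeInclusionDescentProofs
import Literature.NumberTheory.EllipticCurves.CMEndomorphismOfCertificate
import Literature.NumberTheory.EllipticCurves.ComplexTorusAddProofs
import HarnessLib

/-!
# Elliptic curves over `ℚ` with commensurable period lattices are `ℚ`-isogenous

Topic `NumberTheory/EllipticCurves`; a proofs-only file (theorems only: no definitions, no named
facts). For Weierstrass models `W₁, W₂` over `ℚ` of elliptic curves with Néron-type period
pairs `L₁, L₂` (`g₂ = c₄/12`, `g₃ = c₆/216`: the period lattices `Λ₁, Λ₂` of the invariant
differentials of `W₁/ℂ`, `W₂/ℂ`) and `c ∈ ℚˣ` with `cΛ₁ ⊆ Λ₂`, the analytic isogeny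
`ℂ/Λ₁ → ℂ/Λ₂`, `z ↦ cz` (Silverman, *AEC*, Thm. VI.4.1 (b): `Hom(E₁, E₂) ≅ {α : αΛ₁ ⊆ Λ₂}`
over `ℂ`) is an isogeny `W₁ → W₂` **defined over `ℚ`** (`isIsogenous_of_forall_mul_mem_lattice`,
an inhabitant of the tree's `WeierstrassCurve.IsIsogenous`). This is the converse of the
tree's `neronLattice_commensurable_of_isIsogenous_holds`
(`EichlerShimuraConstructionLatticeProofs`: a `ℚ`-isogeny gives `aΛ ⊆ Λ'`), and it is what
makes two elliptic curves over `ℚ` attached to the same newform — e.g. a curve `E` with a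
modular parametrisation by `f` (so `cΛ_f ⊆ Λ_E`) and the curve `E_f = ℂ/Λ_f` over `ℚ`
(`IsNewform0.exists_shortModel_periodLattice`) — `ℚ`-isogenous, hence with the same
`L`-function (`WeierstrassCurve.IsIsogenous.LFunction_eq`).

The arithmetic input is the sibling `LatticeInclusionDescentProofs.lean`: since the invariants
of `Λ₁` and `Λ' = c⁻¹Λ₂` are rational, `℘_{Λ'} = (P₀/Q₀)(℘_{Λ₁})` with `P₀, Q₀ ∈ ℚ[X]`
(`PeriodPair.exists_rat_polynomial_weierstrassP_mul_eval_eq_of_le`), so in the coordinates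
`x = ℘ − b₂/12`, `2y + a₁x + a₃ = ℘′` of the uniformisations `uᵢ : ℂ/Λᵢ ≅ Wᵢ(ℂ)`
(`PeriodPair.exists_addMonoidHom_of_g₂_g₃'`, AEC VI.3.6) the map `u₁(z) ↦ u₂(cz)` is
`(x, y) ↦ (X₂(x), Y₂(x, y))` with `X₂, Y₂` rational functions over `ℚ`
(`map_some_eq_uniformize_mul_of_transformation`). The rest is the transport of the tree's
`CMEndomorphismOfCertificate` (complex multiplications as algebraic endomorphisms) to two
curves: along an embedding `j : ℚ̄ → ℂ` the analytic map preserves `j(W₁(ℚ̄))` (off a finite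
set by the formula; a cofinite subgroup of the infinite group `W₁(ℚ̄)` is everything,
`AddSubgroup.eq_top_of_finite_compl`), its restriction `φ` is algebraic (`IsAlgebraicOn`) with
finite kernel (`IsAlgebraicOn.finite_ker`), and `φ` commutes with `Γ_ℚ` because `P ↦ φ(τP)`
and `P ↦ τφ(P)` are homomorphisms agreeing with the `ℚ`-rational formula off a finite set
(`AddMonoidHom.eq_of_eqOn_compl_finite`) — no automorphism of `ℂ` is needed at this stage, the
descent having been done on the transformation polynomials.

* `exists_addMonoidHom_apply_eq` — factorisation of an additive map through a surjection;
* `eval_aeval_X_zero_add_C` — evaluation of `p(X₀ + β) ∈ ℚ̄[X₀, X₁]`;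
* `map_some_eq_uniformize_mul_of_transformation` — the formula for `u₁(z) ↦ u₂(cz)` on
  `ℚ̄`-points;
* `isIsogenous_of_forall_mul_mem_lattice` — **the theorem**.

Everything is proved; no named facts are introduced and no statement of the tree is changed.

## References

* J. H. Silverman, *The Arithmetic of Elliptic Curves*, 2nd ed., GTM 106, Springer 2009:
  Prop. VI.3.6, Thm. VI.4.1, Thm. VI.5.3, III.4 (isogenies in coordinates). [SilvermanAEC2009]
* D. A. Cox, *Primes of the form x² + ny²*, 2nd ed., Wiley 2013: Prop. 14.9 and §14.B (the
  complex-multiplication analogue `α(x, y) = (R(x), α⁻¹R′(x)y)`). [Cox2013]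
-/

noncomputable section

open scoped Classical
open Complex Set Polynomial Filter Topology
open Literature.NumberTheory.EllipticCurves

namespace Literature.NumberTheory.EllipticCurves

open WeierstrassCurve PeriodPair

/-! ### Two auxiliaries -/

/-- **Factorisation through a surjection.** If `u : ℂ →+ A` is surjective and `ψ : ℂ →+ B` kills
every `z` with `u z = 0`, then `ψ = Φ ∘ u` for an additive `Φ : A →+ B` (the first
isomorphism theorem); used for `A = E₁(ℂ) ≅ ℂ/Λ₁` and `ψ = (z ↦ u₂ (c z))`. [folklore] -/
theorem exists_addMonoidHom_apply_eq {A B : Type*} [AddCommGroup A] [AddCommGroup B]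
    (u : ℂ →+ A) (hu : Function.Surjective u) (ψ : ℂ →+ B)
    (hker : ∀ z, u z = 0 → ψ z = 0) : ∃ Φ : A →+ B, ∀ z, Φ (u z) = ψ z := by
  have hle : u.ker ≤ ψ.ker := fun z hz ↦ by
    rw [AddMonoidHom.mem_ker] at hz ⊢
    exact hker z hz
  set e := QuotientAddGroup.quotientKerEquivOfSurjective u hu with he
  refine ⟨(QuotientAddGroup.lift u.ker ψ hle).comp e.symm.toAddMonoidHom, fun z ↦ ?_⟩
  have hsymm : e.symm (u z) = (QuotientAddGroup.mk z : ℂ ⧸ u.ker) := by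
    rw [AddEquiv.symm_apply_eq]
    rfl
  rw [AddMonoidHom.coe_comp, Function.comp_apply, AddEquiv.coe_toAddMonoidHom, hsymm,
    QuotientAddGroup.lift_mk]

/-- Evaluating `p(X₀ + β) ∈ ℚ̄[X₀, X₁]` (`p ∈ ℚ[X]`) at `(x, y)` gives `p(x + β)`. [folklore] -/
theorem eval_aeval_X_zero_add_C (p : ℚ[X]) (β x y : (AlgebraicClosure ℚ)) :
    MvPolynomial.eval ![x, y]
      (Polynomial.aeval (MvPolynomial.X 0 + MvPolynomial.C β : MvPolynomial (Fin 2) (AlgebraicClosure ℚ)) p) =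
      Polynomial.aeval (x + β) p := by
  have h1 : ((MvPolynomial.aeval ![x, y] : MvPolynomial (Fin 2) (AlgebraicClosure ℚ) →ₐ[(AlgebraicClosure ℚ)] (AlgebraicClosure ℚ)).restrictScalars ℚ)
      (MvPolynomial.X 0 + MvPolynomial.C β) = x + β := by
    simp
  rw [← MvPolynomial.coe_aeval_eq_eval]
  have h2 := Polynomial.aeval_algHom_apply
    ((MvPolynomial.aeval ![x, y] : MvPolynomial (Fin 2) (AlgebraicClosure ℚ) →ₐ[(AlgebraicClosure ℚ)] (AlgebraicClosure ℚ)).restrictScalars ℚ)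
    (MvPolynomial.X 0 + MvPolynomial.C β : MvPolynomial (Fin 2) (AlgebraicClosure ℚ)) p
  rw [h1] at h2
  rw [h2]
  rfl


/-! ### The analytic isogeny in coordinates -/

/-- **The analytic isogeny `z ↦ cz` in coordinates, on `ℚ̄`-points.** Let `W₁, W₂` be Weierstrass
curves over `ℚ` with complex uniformisations `uᵢ : ℂ → Wᵢ(ℂ)`,
`uᵢ(z) = (℘_{Λᵢ}(z) − b₂/12, (℘′_{Λᵢ}(z) − a₁x − a₃)/2)` off `Λᵢ` (Silverman, *AEC*, VI.3.6 with
the completion of the square of III.1), let `c ∈ ℚ` with `cΛ₁ ⊆ Λ₂`, `Λ' = c⁻¹Λ₂` (so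
`℘_{Λ₂}(cz) = c⁻²℘_{Λ'}(z)`, `℘′_{Λ₂}(cz) = c⁻³℘′_{Λ'}(z)`), and let `P₀, Q₀ ∈ ℚ[X]` transform
`℘_{Λ₁}` into `℘_{Λ'}`: `℘_{Λ'}·Q₀(℘_{Λ₁}) = P₀(℘_{Λ₁})`, `Q₀(℘_{Λ₁}) ≠ 0` off `Λ'`, with the
derivative `℘′_{Λ'}·Q₀(℘_{Λ₁})² = ℘′_{Λ₁}·(P₀′Q₀ − P₀Q₀′)(℘_{Λ₁})`
(`PeriodPair.exists_rat_polynomial_weierstrassP_mul_eval_eq_of_le`,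
`PeriodPair.derivWeierstrassP_mul_eval_sq_eq_of_le`). If an affine point `(x, y) ∈ W₁(ℚ̄)` maps
under `j : ℚ̄ → ℂ` to `u₁(z)` with `z ∉ Λ'`, then `u₂(cz)` is the `j`-image of the explicit
`ℚ̄`-point `(X₂, Y₂)` of `W₂`,
`X₂ = (c⁻²P₀ − (b₂′/12)Q₀)/Q₀ (x + b₂/12)`,
`Y₂ = (c⁻³(P₀′Q₀ − P₀Q₀′)(x + b₂/12)·(2y + a₁x + a₃) − a₁′X₂Q₀² − a₃′Q₀²)/(2Q₀²)` — the
isogeny `(x, y) ↦ (T(x), T′(x)·y)` of Silverman, *AEC*, III.4 / Thm. VI.4.1 written for the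
general Weierstrass models (`x = ℘ − b₂/12`, `2y + a₁x + a₃ = ℘′`). In particular its
coordinates are rational functions over `ℚ` of `(x, y)`. [cite: SilvermanAEC2009, Thm. VI.4.1] -/
theorem map_some_eq_uniformize_mul_of_transformation
    {W₁ W₂ : WeierstrassCurve ℚ} {L₁ L₂ L' : PeriodPair} (j : (AlgebraicClosure ℚ) →ₐ[ℚ] ℂ)
    {u₁ : ℂ →+ (W₁.baseChange ℂ).toAffine.Point} {u₂ : ℂ →+ (W₂.baseChange ℂ).toAffine.Point}
    (hu₁ : ∀ z ∉ L₁.lattice, ∃ h, u₁ z = .some (℘[L₁] z - (W₁.baseChange ℂ).b₂ / 12)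
        ((℘'[L₁] z - (W₁.baseChange ℂ).a₁ * (℘[L₁] z - (W₁.baseChange ℂ).b₂ / 12)
          - (W₁.baseChange ℂ).a₃) / 2) h)
    (hu₂ : ∀ z ∉ L₂.lattice, ∃ h, u₂ z = .some (℘[L₂] z - (W₂.baseChange ℂ).b₂ / 12)
        ((℘'[L₂] z - (W₂.baseChange ℂ).a₁ * (℘[L₂] z - (W₂.baseChange ℂ).b₂ / 12)
          - (W₂.baseChange ℂ).a₃) / 2) h)
    {c : ℚ} (hle : ∀ z ∈ L₁.lattice, (c : ℂ) * z ∈ L₂.lattice)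
    (hL' : ∀ z, z ∈ L'.lattice ↔ (c : ℂ) * z ∈ L₂.lattice)
    (h℘ : ∀ z, ℘[L₂] (c * z) = ((c : ℂ)⁻¹) ^ 2 * ℘[L'] z)
    (h℘' : ∀ z, ℘'[L₂] (c * z) = ((c : ℂ)⁻¹) ^ 3 * ℘'[L'] z)
    {P₀ Q₀ : ℚ[X]} (hQ : ∀ z ∉ L'.lattice, aeval (℘[L₁] z) Q₀ ≠ 0)
    (hPQ : ∀ z ∉ L'.lattice, ℘[L'] z * aeval (℘[L₁] z) Q₀ = aeval (℘[L₁] z) P₀)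
    (hder : ∀ z ∉ L'.lattice, ℘'[L'] z * aeval (℘[L₁] z) Q₀ ^ 2 =
      ℘'[L₁] z * aeval (℘[L₁] z) (derivative P₀ * Q₀ - P₀ * derivative Q₀))
    {x y : (AlgebraicClosure ℚ)} (hxy : (W₁.baseChange (AlgebraicClosure ℚ)).toAffine.Nonsingular x y) {z : ℂ} (hzL' : z ∉ L'.lattice)
    (hz : Affine.Point.map j (.some x y hxy) = u₁ z) :
    ∃ h₂ : (W₂.baseChange (AlgebraicClosure ℚ)).toAffine.Nonsingular
        (((algebraMap ℚ (AlgebraicClosure ℚ) c)⁻¹ ^ 2 * aeval (x + algebraMap ℚ (AlgebraicClosure ℚ) W₁.b₂ / 12) P₀ -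
            algebraMap ℚ (AlgebraicClosure ℚ) W₂.b₂ / 12 * aeval (x + algebraMap ℚ (AlgebraicClosure ℚ) W₁.b₂ / 12) Q₀) /
          aeval (x + algebraMap ℚ (AlgebraicClosure ℚ) W₁.b₂ / 12) Q₀)
        (((algebraMap ℚ (AlgebraicClosure ℚ) c)⁻¹ ^ 3 *
              aeval (x + algebraMap ℚ (AlgebraicClosure ℚ) W₁.b₂ / 12) (derivative P₀ * Q₀ - P₀ * derivative Q₀) *
              (2 * y + algebraMap ℚ (AlgebraicClosure ℚ) W₁.a₁ * x + algebraMap ℚ (AlgebraicClosure ℚ) W₁.a₃) -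
            algebraMap ℚ (AlgebraicClosure ℚ) W₂.a₁ *
              ((algebraMap ℚ (AlgebraicClosure ℚ) c)⁻¹ ^ 2 * aeval (x + algebraMap ℚ (AlgebraicClosure ℚ) W₁.b₂ / 12) P₀ -
                algebraMap ℚ (AlgebraicClosure ℚ) W₂.b₂ / 12 * aeval (x + algebraMap ℚ (AlgebraicClosure ℚ) W₁.b₂ / 12) Q₀) *
              aeval (x + algebraMap ℚ (AlgebraicClosure ℚ) W₁.b₂ / 12) Q₀ -
            algebraMap ℚ (AlgebraicClosure ℚ) W₂.a₃ * aeval (x + algebraMap ℚ (AlgebraicClosure ℚ) W₁.b₂ / 12) Q₀ ^ 2) /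
          (2 * aeval (x + algebraMap ℚ (AlgebraicClosure ℚ) W₁.b₂ / 12) Q₀ ^ 2)),
      Affine.Point.map j (.some _ _ h₂) = u₂ (c * z) := by
  -- `z ∉ Λ₁`, and the coordinates of `u₁ z`
  have hz1 : z ∉ L₁.lattice := fun h ↦ hzL' ((hL' z).mpr (hle z h))
  obtain ⟨h1, hu1z⟩ := hu₁ z hz1
  have hz' := hz
  rw [hu1z] at hz'
  erw [Affine.Point.map_some] at hz'
  obtain ⟨hx, hy⟩ := Affine.Point.some.inj hz'
  -- `cz ∉ Λ₂`, and the coordinates of `u₂ (cz)`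
  have hcz : (c : ℂ) * z ∉ L₂.lattice := fun h ↦ hzL' ((hL' z).mpr h)
  obtain ⟨h2, hu2⟩ := hu₂ _ hcz
  -- constants
  have ha₁ : (W₁.baseChange ℂ).a₁ = algebraMap ℚ ℂ W₁.a₁ := rfl
  have ha₃ : (W₁.baseChange ℂ).a₃ = algebraMap ℚ ℂ W₁.a₃ := rfl
  have ha₁' : (W₂.baseChange ℂ).a₁ = algebraMap ℚ ℂ W₂.a₁ := rfl
  have ha₃' : (W₂.baseChange ℂ).a₃ = algebraMap ℚ ℂ W₂.a₃ := rfl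
  have hb₂ : (W₁.baseChange ℂ).b₂ = algebraMap ℚ ℂ W₁.b₂ := by
    rw [WeierstrassCurve.baseChange, WeierstrassCurve.map_b₂]
  have hb₂' : (W₂.baseChange ℂ).b₂ = algebraMap ℚ ℂ W₂.b₂ := by
    rw [WeierstrassCurve.baseChange, WeierstrassCurve.map_b₂]
  -- evaluations through `j`
  set t : ℂ := ℘[L₁] z with ht
  have hjt : j (x + algebraMap ℚ (AlgebraicClosure ℚ) W₁.b₂ / 12) = t := by
    rw [map_add, map_div₀, AlgHom.commutes, map_ofNat, hx, hb₂]
    ring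
  have hjQ : j (aeval (x + algebraMap ℚ (AlgebraicClosure ℚ) W₁.b₂ / 12) Q₀) = aeval t Q₀ := by
    rw [← aeval_algHom_apply, hjt]
  have hjP : j (aeval (x + algebraMap ℚ (AlgebraicClosure ℚ) W₁.b₂ / 12) P₀) = aeval t P₀ := by
    rw [← aeval_algHom_apply, hjt]
  have hjN : j (aeval (x + algebraMap ℚ (AlgebraicClosure ℚ) W₁.b₂ / 12) (derivative P₀ * Q₀ - P₀ * derivative Q₀)) =
      aeval t (derivative P₀ * Q₀ - P₀ * derivative Q₀) := by
    rw [← aeval_algHom_apply, hjt]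
  have hjc : j (algebraMap ℚ (AlgebraicClosure ℚ) c) = (c : ℂ) := by rw [AlgHom.commutes, eq_ratCast]
  have hqv : aeval t Q₀ ≠ 0 := hQ z hzL'
  set nC : ℂ := aeval t (derivative P₀ * Q₀ - P₀ * derivative Q₀) with hnC
  -- the analytic identities at `z`
  have E1 : ℘[L'] z = aeval t P₀ / aeval t Q₀ := by
    rw [eq_div_iff hqv]; exact hPQ z hzL'
  have E2 : ℘'[L'] z = ℘'[L₁] z * aeval t (derivative P₀ * Q₀ - P₀ * derivative Q₀) /
      aeval t Q₀ ^ 2 := by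
    rw [eq_div_iff (pow_ne_zero 2 hqv)]; exact hder z hzL'
  have E3 : ℘'[L₁] z = 2 * j y + (W₁.baseChange ℂ).a₁ * j x + (W₁.baseChange ℂ).a₃ := by
    rw [hy, hx]; ring
  -- the coordinates agree
  set qv := aeval (x + algebraMap ℚ (AlgebraicClosure ℚ) W₁.b₂ / 12) Q₀ with hqvdef
  set pv := aeval (x + algebraMap ℚ (AlgebraicClosure ℚ) W₁.b₂ / 12) P₀ with hpvdef
  set nv := aeval (x + algebraMap ℚ (AlgebraicClosure ℚ) W₁.b₂ / 12) (derivative P₀ * Q₀ - P₀ * derivative Q₀)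
    with hnvdef
  have hX : j (((algebraMap ℚ (AlgebraicClosure ℚ) c)⁻¹ ^ 2 * pv - algebraMap ℚ (AlgebraicClosure ℚ) W₂.b₂ / 12 * qv) / qv) =
      ℘[L₂] (c * z) - (W₂.baseChange ℂ).b₂ / 12 := by
    simp only [map_div₀, map_sub, map_mul, map_pow, map_inv₀, map_ofNat, hjc, hjP, hjQ,
      AlgHom.commutes]
    rw [← hb₂', h℘ z, E1]
    field_simp
  have hY : j (((algebraMap ℚ (AlgebraicClosure ℚ) c)⁻¹ ^ 3 * nv *
              (2 * y + algebraMap ℚ (AlgebraicClosure ℚ) W₁.a₁ * x + algebraMap ℚ (AlgebraicClosure ℚ) W₁.a₃) -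
            algebraMap ℚ (AlgebraicClosure ℚ) W₂.a₁ * ((algebraMap ℚ (AlgebraicClosure ℚ) c)⁻¹ ^ 2 * pv - algebraMap ℚ (AlgebraicClosure ℚ) W₂.b₂ / 12 * qv) *
              qv - algebraMap ℚ (AlgebraicClosure ℚ) W₂.a₃ * qv ^ 2) / (2 * qv ^ 2)) =
      (℘'[L₂] (c * z) - (W₂.baseChange ℂ).a₁ * (℘[L₂] (c * z) - (W₂.baseChange ℂ).b₂ / 12)
        - (W₂.baseChange ℂ).a₃) / 2 := by
    simp only [map_div₀, map_sub, map_mul, map_add, map_pow, map_inv₀, map_ofNat, hjc, hjP, hjQ,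
      hjN, AlgHom.commutes]
    rw [← hb₂', ← ha₁, ← ha₃, ← ha₁', ← ha₃', h℘ z, h℘' z, E1, E2, E3]
    field_simp
    ring
  -- nonsingularity over `ℚ̄` from that of `u₂ (cz)` over `ℂ`
  have hnsC := h2
  rw [← hY, ← hX] at hnsC
  have h₂ := (W₂.toAffine.baseChange_nonsingular j.injective _ _).mp hnsC
  refine ⟨h₂, ?_⟩
  rw [hu2]
  erw [Affine.Point.map_some]
  exact Affine.Point.some.congr_simp _ _ hX _ _ hY _


/-! ### The theorem -/

/-- **Elliptic curves over `ℚ` with commensurable period lattices are `ℚ`-isogenous** (the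
direction `Hom(Λ₁, Λ₂) → Hom_ℚ(E₁, E₂)` of Silverman, *AEC*, Thm. VI.4.1 (b) / VI.5.3, with
descent from `ℂ` to `ℚ`). Let `W₁, W₂` be Weierstrass models over `ℚ`, `W₁` elliptic, with
period pairs `L₁, L₂` of Néron type (`g₂(Lᵢ) = c₄(Wᵢ)/12`, `g₃(Lᵢ) = c₆(Wᵢ)/216`, i.e. `Λᵢ` is
the period lattice of the invariant differential of `Wᵢ/ℂ`), and let `c ∈ ℚˣ` with `cΛ₁ ⊆ Λ₂`.
Then `W₁` and `W₂` are isogenous over `ℚ` (`WeierstrassCurve.IsIsogenous`: an additive,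
generically rational, `Γ_ℚ`-equivariant map on `ℚ̄`-points with finite kernel). Construction:
the analytic isogeny `Φ : W₁(ℂ) ≅ ℂ/Λ₁ → ℂ/Λ₂ ≅ W₂(ℂ)`, `z ↦ cz` (uniformisations
`PeriodPair.exists_addMonoidHom_of_g₂_g₃'`, AEC VI.3.6), is given off a finite set by rational
functions **with rational coefficients** (`map_some_eq_uniformize_mul_of_transformation`, from
`℘_{c⁻¹Λ₂} = (P₀/Q₀)(℘_{Λ₁})` with `P₀, Q₀ ∈ ℚ[X]`,
`PeriodPair.exists_rat_polynomial_weierstrassP_mul_eval_eq_of_le` — the invariants of `Λ₁` and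
`c⁻¹Λ₂` being rational); hence `Φ` maps the image of `W₁(ℚ̄)` under an embedding `j : ℚ̄ → ℂ`
into that of `W₂(ℚ̄)` (a cofinite subgroup of the infinite group `W₁(ℚ̄)` is everything) and
restricts along `j` to an additive map `φ : W₁(ℚ̄) → W₂(ℚ̄)` which is algebraic
(`IsAlgebraicOn`), commutes with `Γ_ℚ` (both `P ↦ φ(τP)` and `P ↦ τφ(P)` are homomorphisms
agreeing with the `ℚ`-rational formula off a finite set), and has finite kernel
(`IsAlgebraicOn.finite_ker`). This is the converse of the tree's
`neronLattice_commensurable_of_isIsogenous_holds` (`ℚ`-isogenous ⇒ `aΛ ⊆ Λ'`).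
[cite: SilvermanAEC2009, Thm. VI.4.1, Thm. VI.5.3] -/
theorem isIsogenous_of_forall_mul_mem_lattice {W₁ W₂ : WeierstrassCurve ℚ} [W₁.IsElliptic]
    {L₁ L₂ : PeriodPair} (h₁₂ : L₁.g₂ = (W₁.baseChange ℂ).c₄ / 12)
    (h₁₃ : L₁.g₃ = (W₁.baseChange ℂ).c₆ / 216) (h₂₂ : L₂.g₂ = (W₂.baseChange ℂ).c₄ / 12)
    (h₂₃ : L₂.g₃ = (W₂.baseChange ℂ).c₆ / 216) {c : ℚ} (hc : c ≠ 0)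
    (hle : ∀ z ∈ L₁.lattice, (c : ℂ) * z ∈ L₂.lattice) : IsIsogenous W₁ W₂ := by
  -- the uniformisations `uᵢ : ℂ/Λᵢ ≅ Wᵢ(ℂ)`
  obtain ⟨u₁, hker₁, hsurj₁, hu₁⟩ := L₁.exists_addMonoidHom_of_g₂_g₃' h₁₂ h₁₃
  obtain ⟨u₂, hker₂, -, hu₂⟩ := L₂.exists_addMonoidHom_of_g₂_g₃' h₂₂ h₂₃
  have hu₁0 : ∀ z, u₁ z = 0 ↔ z ∈ L₁.lattice := fun z ↦ by
    rw [← SetLike.mem_coe, ← hker₁, SetLike.mem_coe, AddMonoidHom.mem_ker]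
  have hu₂0 : ∀ z, u₂ z = 0 ↔ z ∈ L₂.lattice := fun z ↦ by
    rw [← SetLike.mem_coe, ← hker₂, SetLike.mem_coe, AddMonoidHom.mem_ker]
  -- the lattice `Λ' = c⁻¹Λ₂ ⊇ Λ₁`
  have hcC : (c : ℂ) ≠ 0 := by exact_mod_cast hc
  have hci : (c : ℂ)⁻¹ ≠ 0 := inv_ne_zero hcC
  set L' : PeriodPair := L₂.mulLeft ((c : ℂ)⁻¹) hci with hL'def
  have hL' : ∀ z, z ∈ L'.lattice ↔ (c : ℂ) * z ∈ L₂.lattice := fun z ↦ by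
    rw [hL'def, PeriodPair.mem_mulLeft_lattice, inv_inv]
  have hLL' : L₁.lattice ≤ L'.lattice := fun z hz ↦ (hL' z).mpr (hle z hz)
  have h℘ : ∀ z, ℘[L₂] (c * z) = ((c : ℂ)⁻¹) ^ 2 * ℘[L'] z := fun z ↦ by
    have h := PeriodPair.weierstrassP_mulLeft ((c : ℂ)⁻¹) hci L₂ (c * z)
    rw [inv_mul_cancel_left₀ hcC, ← hL'def] at h
    rw [h, ← mul_assoc, mul_inv_cancel₀ (pow_ne_zero 2 hci), one_mul]
  have h℘' : ∀ z, ℘'[L₂] (c * z) = ((c : ℂ)⁻¹) ^ 3 * ℘'[L'] z := fun z ↦ by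
    have h := PeriodPair.derivWeierstrassP_mulLeft ((c : ℂ)⁻¹) hci L₂ (c * z)
    rw [inv_mul_cancel_left₀ hcC, ← hL'def] at h
    rw [h, ← mul_assoc, mul_inv_cancel₀ (pow_ne_zero 3 hci), one_mul]
  -- the invariants are rational
  have hg₂ : ∃ q : ℚ, (q : ℂ) = L₁.g₂ :=
    ⟨W₁.c₄ / 12, by rw [h₁₂, WeierstrassCurve.baseChange, WeierstrassCurve.map_c₄, eq_ratCast]; push_cast; ring⟩
  have hg₃ : ∃ q : ℚ, (q : ℂ) = L₁.g₃ :=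
    ⟨W₁.c₆ / 216, by rw [h₁₃, WeierstrassCurve.baseChange, WeierstrassCurve.map_c₆, eq_ratCast]; push_cast; ring⟩
  have hg₂' : ∃ q : ℚ, (q : ℂ) = L'.g₂ :=
    ⟨c ^ 4 * W₂.c₄ / 12, by
      rw [hL'def, PeriodPair.g₂_mulLeft, h₂₂, WeierstrassCurve.baseChange, WeierstrassCurve.map_c₄,
        eq_ratCast, inv_pow, inv_inv]; push_cast; ring⟩
  have hg₃' : ∃ q : ℚ, (q : ℂ) = L'.g₃ :=
    ⟨c ^ 6 * W₂.c₆ / 216, by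
      rw [hL'def, PeriodPair.g₃_mulLeft, h₂₃, WeierstrassCurve.baseChange, WeierstrassCurve.map_c₆,
        eq_ratCast, inv_pow, inv_inv]; push_cast; ring⟩
  -- the transformation `℘_{Λ'} = (P₀/Q₀)(℘_{Λ₁})` over `ℚ`, and its derivative
  obtain ⟨P₀, Q₀, hQ₀m, -, hQ', hPQ'⟩ :=
    L₁.exists_rat_polynomial_weierstrassP_mul_eval_eq_of_le L' hLL' hg₂ hg₃ hg₂' hg₃'
  have hQ : ∀ z ∉ L'.lattice, aeval (℘[L₁] z) Q₀ ≠ 0 := fun z hz ↦ by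
    rw [← eval_map_algebraMap]; exact hQ' z hz
  have hPQ : ∀ z ∉ L'.lattice, ℘[L'] z * aeval (℘[L₁] z) Q₀ = aeval (℘[L₁] z) P₀ := fun z hz ↦ by
    rw [← eval_map_algebraMap, ← eval_map_algebraMap]; exact hPQ' z hz
  have hder : ∀ z ∉ L'.lattice, ℘'[L'] z * aeval (℘[L₁] z) Q₀ ^ 2 =
      ℘'[L₁] z * aeval (℘[L₁] z) (derivative P₀ * Q₀ - P₀ * derivative Q₀) := fun z hz ↦ by
    have h := L₁.derivWeierstrassP_mul_eval_sq_eq_of_le L' hLL' hPQ' hz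
    rw [Polynomial.derivative_map, Polynomial.derivative_map, ← Polynomial.map_mul,
      ← Polynomial.map_mul, ← Polynomial.map_sub, eval_map_algebraMap, eval_map_algebraMap] at h
    exact h
  -- freeze the numerator of the derivative of the transformation
  set N₀ : ℚ[X] := derivative P₀ * Q₀ - P₀ * derivative Q₀ with hN₀
  -- an embedding `j : ℚ̄ → ℂ` and the induced injections on points
  haveI hQbar : Algebra.IsAlgebraic ℚ (AlgebraicClosure ℚ) := AlgebraicClosure.isAlgebraic ℚ
  obtain ⟨j⟩ : Nonempty ((AlgebraicClosure ℚ) →ₐ[ℚ] ℂ) := ⟨IsAlgClosed.lift⟩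
  set jW₁ := (Affine.Point.map (W' := W₁) j : W₁.geomPoints →+ (W₁.baseChange ℂ).toAffine.Point)
    with hjW₁
  set jW₂ := (Affine.Point.map (W' := W₂) j : W₂.geomPoints →+ (W₂.baseChange ℂ).toAffine.Point)
    with hjW₂
  have hj₁ : Function.Injective jW₁ := Affine.Point.map_injective (W' := W₁) j
  have hj₂ : Function.Injective jW₂ := Affine.Point.map_injective (W' := W₂) j
  -- the analytic isogeny `Φ : W₁(ℂ) → W₂(ℂ)`, `u₁ z ↦ u₂ (cz)`
  obtain ⟨Φ, hΦ⟩ : ∃ Φ : (W₁.baseChange ℂ).toAffine.Point →+ (W₂.baseChange ℂ).toAffine.Point,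
      ∀ z, Φ (u₁ z) = u₂ (c * z) := by
    refine exists_addMonoidHom_apply_eq u₁ hsurj₁ (u₂.comp (AddMonoidHom.mulLeft (c : ℂ)))
      fun z hz ↦ ?_
    rw [AddMonoidHom.coe_comp, Function.comp_apply, AddMonoidHom.coe_mulLeft, hu₂0]
    exact hle z ((hu₁0 z).mp hz)
  -- representatives of `Λ'/Λ₁` and the finite exceptional set
  obtain ⟨S, hS0, -, hS, -⟩ := L₁.exists_finset_representatives L' hLL'
  have hkerΦ : ∀ z, Φ (u₁ z) = 0 → u₁ z ∈ u₁ '' (S : Set ℂ) := by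
    intro z hz
    rw [hΦ, hu₂0, ← hL'] at hz
    obtain ⟨s, hs, hzs⟩ := (hS z).mp hz
    refine ⟨s, hs, ?_⟩
    have h0 : u₁ (z - s) = 0 := (hu₁0 _).mpr hzs
    rwa [map_sub, sub_eq_zero, eq_comm] at h0
  set β₁ : (AlgebraicClosure ℚ) := algebraMap ℚ (AlgebraicClosure ℚ) W₁.b₂ / 12 with hβ₁
  set Bad : Set W₁.geomPoints := {m | jW₁ m ∈ u₁ '' (S : Set ℂ)} ∪
    {m | ∃ (x y : (AlgebraicClosure ℚ)) (h : (W₁.baseChange (AlgebraicClosure ℚ)).toAffine.Nonsingular x y),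
      m = .some x y h ∧ ((Q₀.map (algebraMap ℚ (AlgebraicClosure ℚ))).comp (X + C β₁)).eval x = 0} with hBad
  have hBadfin : Bad.Finite := by
    refine Set.Finite.union ?_ ?_
    · exact (S.finite_toSet.image u₁).preimage hj₁.injOn
    · refine finite_setOf_eval_x_eq_zero W₁ (Monic.ne_zero ?_)
      exact (hQ₀m.map _).comp (monic_X_add_C β₁) (by rw [natDegree_X_add_C]; exact one_ne_zero)
  have hevalQ : ∀ x : (AlgebraicClosure ℚ), ((Q₀.map (algebraMap ℚ (AlgebraicClosure ℚ))).comp (X + C β₁)).eval x = aeval (x + β₁) Q₀ := by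
    intro x
    rw [eval_comp, eval_add, eval_X, eval_C, eval_map_algebraMap]
  -- good points: affine, `Q₀(x + β₁) ≠ 0`, and `j m = u₁ z` with `z ∉ Λ'`
  have hgood : ∀ m : W₁.geomPoints, m ∉ Bad → ∃ (x y : (AlgebraicClosure ℚ))
      (h : (W₁.baseChange (AlgebraicClosure ℚ)).toAffine.Nonsingular x y), m = .some x y h ∧
      aeval (x + β₁) Q₀ ≠ 0 ∧ ∃ z, z ∉ L'.lattice ∧ jW₁ m = u₁ z := by
    intro m hm
    simp only [hBad, Set.mem_union, Set.mem_setOf_eq, not_or, not_exists, not_and] at hm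
    obtain ⟨z, hz⟩ := hsurj₁ (jW₁ m)
    have hzL' : z ∉ L'.lattice := by
      intro hzm
      obtain ⟨s, hs, hzs⟩ := (hS z).mp hzm
      apply hm.1
      refine ⟨s, hs, ?_⟩
      have h0 : u₁ (z - s) = 0 := (hu₁0 _).mpr hzs
      rw [map_sub, sub_eq_zero] at h0
      rw [← hz, h0]
    rcases m with _ | ⟨x, y, h⟩
    · exfalso
      apply hm.1
      refine ⟨0, hS0, ?_⟩
      rw [map_zero]
      exact (map_zero jW₁).symm
    · refine ⟨x, y, h, rfl, ?_, z, hzL', hz.symm⟩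
      rw [← hevalQ]
      exact hm.2 x y h rfl
  -- the `ℚ̄`-rational formula for `Φ` at good points
  have hformula : ∀ {x y : (AlgebraicClosure ℚ)} (hxy : (W₁.baseChange (AlgebraicClosure ℚ)).toAffine.Nonsingular x y) {z : ℂ},
      z ∉ L'.lattice → jW₁ (.some x y hxy) = u₁ z →
      ∃ h₂ : (W₂.baseChange (AlgebraicClosure ℚ)).toAffine.Nonsingular
        (((algebraMap ℚ (AlgebraicClosure ℚ) c)⁻¹ ^ 2 * aeval (x + algebraMap ℚ (AlgebraicClosure ℚ) W₁.b₂ / 12) P₀ -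
            algebraMap ℚ (AlgebraicClosure ℚ) W₂.b₂ / 12 * aeval (x + algebraMap ℚ (AlgebraicClosure ℚ) W₁.b₂ / 12) Q₀) /
          aeval (x + algebraMap ℚ (AlgebraicClosure ℚ) W₁.b₂ / 12) Q₀)
        (((algebraMap ℚ (AlgebraicClosure ℚ) c)⁻¹ ^ 3 *
              aeval (x + algebraMap ℚ (AlgebraicClosure ℚ) W₁.b₂ / 12) N₀ *
              (2 * y + algebraMap ℚ (AlgebraicClosure ℚ) W₁.a₁ * x + algebraMap ℚ (AlgebraicClosure ℚ) W₁.a₃) -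
            algebraMap ℚ (AlgebraicClosure ℚ) W₂.a₁ *
              ((algebraMap ℚ (AlgebraicClosure ℚ) c)⁻¹ ^ 2 * aeval (x + algebraMap ℚ (AlgebraicClosure ℚ) W₁.b₂ / 12) P₀ -
                algebraMap ℚ (AlgebraicClosure ℚ) W₂.b₂ / 12 * aeval (x + algebraMap ℚ (AlgebraicClosure ℚ) W₁.b₂ / 12) Q₀) *
              aeval (x + algebraMap ℚ (AlgebraicClosure ℚ) W₁.b₂ / 12) Q₀ -
            algebraMap ℚ (AlgebraicClosure ℚ) W₂.a₃ * aeval (x + algebraMap ℚ (AlgebraicClosure ℚ) W₁.b₂ / 12) Q₀ ^ 2) /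
          (2 * aeval (x + algebraMap ℚ (AlgebraicClosure ℚ) W₁.b₂ / 12) Q₀ ^ 2)),
      jW₂ (.some _ _ h₂) = Φ (jW₁ (.some x y hxy)) := by
    intro x y hxy z hzL' hz
    obtain ⟨h₂, hh₂⟩ := map_some_eq_uniformize_mul_of_transformation j hu₁ hu₂ hle hL' h℘ h℘'
      hQ hPQ hder hxy hzL' hz
    exact ⟨h₂, by rw [hz, hΦ]; exact hh₂⟩
  -- `Φ` preserves `j(W₁(ℚ̄))`
  have hpres : ∀ m : W₁.geomPoints, Φ (jW₁ m) ∈ jW₂.range := by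
    set T : AddSubgroup W₁.geomPoints := (jW₂.range.comap Φ).comap jW₁ with hT
    have hTtop : T = ⊤ := by
      refine AddSubgroup.eq_top_of_finite_compl T (hBadfin.subset fun m hm ↦ ?_)
      by_contra hmB
      apply hm
      obtain ⟨x, y, h, rfl, -, z, hzL', hz⟩ := hgood m hmB
      obtain ⟨h₂, hm₂⟩ := hformula h hzL' hz
      rw [hT, SetLike.mem_coe, AddSubgroup.mem_comap, AddSubgroup.mem_comap]
      exact ⟨_, hm₂⟩
    intro m
    have : m ∈ T := by rw [hTtop]; exact AddSubgroup.mem_top m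
    rw [hT, AddSubgroup.mem_comap, AddSubgroup.mem_comap] at this
    exact this
  -- the restriction `φ` of `Φ` along `j`
  set eR : W₂.geomPoints ≃+ jW₂.range := AddMonoidHom.ofInjective hj₂ with heR
  set φ : W₁.geomPoints →+ W₂.geomPoints :=
    eR.symm.toAddMonoidHom.comp ((Φ.comp jW₁).codRestrict jW₂.range fun m ↦ hpres m) with hφ
  have hfφ : ∀ m, jW₂ (φ m) = Φ (jW₁ m) := by
    intro m
    have h1 : ((eR (φ m) : jW₂.range) : (W₂.baseChange ℂ).toAffine.Point) = jW₂ (φ m) :=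
      AddMonoidHom.ofInjective_apply hj₂
    rw [← h1, hφ, AddMonoidHom.coe_comp, Function.comp_apply, AddEquiv.coe_toAddMonoidHom,
      AddEquiv.apply_symm_apply]
    rfl
  -- the value of `φ` at a good point
  have hφval : ∀ {x y : (AlgebraicClosure ℚ)} (hxy : (W₁.baseChange (AlgebraicClosure ℚ)).toAffine.Nonsingular x y) {z : ℂ},
      z ∉ L'.lattice → jW₁ (.some x y hxy) = u₁ z → ∃ h₂, φ (.some x y hxy) = .some
        (((algebraMap ℚ (AlgebraicClosure ℚ) c)⁻¹ ^ 2 * aeval (x + algebraMap ℚ (AlgebraicClosure ℚ) W₁.b₂ / 12) P₀ -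
            algebraMap ℚ (AlgebraicClosure ℚ) W₂.b₂ / 12 * aeval (x + algebraMap ℚ (AlgebraicClosure ℚ) W₁.b₂ / 12) Q₀) /
          aeval (x + algebraMap ℚ (AlgebraicClosure ℚ) W₁.b₂ / 12) Q₀)
        (((algebraMap ℚ (AlgebraicClosure ℚ) c)⁻¹ ^ 3 *
              aeval (x + algebraMap ℚ (AlgebraicClosure ℚ) W₁.b₂ / 12) N₀ *
              (2 * y + algebraMap ℚ (AlgebraicClosure ℚ) W₁.a₁ * x + algebraMap ℚ (AlgebraicClosure ℚ) W₁.a₃) -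
            algebraMap ℚ (AlgebraicClosure ℚ) W₂.a₁ *
              ((algebraMap ℚ (AlgebraicClosure ℚ) c)⁻¹ ^ 2 * aeval (x + algebraMap ℚ (AlgebraicClosure ℚ) W₁.b₂ / 12) P₀ -
                algebraMap ℚ (AlgebraicClosure ℚ) W₂.b₂ / 12 * aeval (x + algebraMap ℚ (AlgebraicClosure ℚ) W₁.b₂ / 12) Q₀) *
              aeval (x + algebraMap ℚ (AlgebraicClosure ℚ) W₁.b₂ / 12) Q₀ -
            algebraMap ℚ (AlgebraicClosure ℚ) W₂.a₃ * aeval (x + algebraMap ℚ (AlgebraicClosure ℚ) W₁.b₂ / 12) Q₀ ^ 2) /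
          (2 * aeval (x + algebraMap ℚ (AlgebraicClosure ℚ) W₁.b₂ / 12) Q₀ ^ 2)) h₂ := by
    intro x y hxy z hzL' hz
    obtain ⟨h₂, hm₂⟩ := hformula hxy hzL' hz
    exact ⟨h₂, hj₂ (by rw [hfφ, hm₂])⟩
  -- `φ` is algebraic
  have halg : IsAlgebraicOn W₁ W₂ φ := by
    set Tm : MvPolynomial (Fin 2) (AlgebraicClosure ℚ) := MvPolynomial.X 0 + MvPolynomial.C β₁ with hTm
    set κ : (AlgebraicClosure ℚ) := (algebraMap ℚ (AlgebraicClosure ℚ) c)⁻¹ with hκ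
    set Pm : MvPolynomial (Fin 2) (AlgebraicClosure ℚ) := MvPolynomial.C (κ ^ 2) * Polynomial.aeval Tm P₀ -
      MvPolynomial.C (algebraMap ℚ (AlgebraicClosure ℚ) W₂.b₂ / 12) * Polynomial.aeval Tm Q₀ with hPm
    refine ⟨Pm, Polynomial.aeval Tm Q₀,
      MvPolynomial.C (κ ^ 3) * Polynomial.aeval Tm N₀ *
          (MvPolynomial.C 2 * MvPolynomial.X 1 + MvPolynomial.C (algebraMap ℚ (AlgebraicClosure ℚ) W₁.a₁) *
            MvPolynomial.X 0 + MvPolynomial.C (algebraMap ℚ (AlgebraicClosure ℚ) W₁.a₃)) -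
        MvPolynomial.C (algebraMap ℚ (AlgebraicClosure ℚ) W₂.a₁) * Pm * Polynomial.aeval Tm Q₀ -
        MvPolynomial.C (algebraMap ℚ (AlgebraicClosure ℚ) W₂.a₃) * Polynomial.aeval Tm Q₀ ^ 2,
      MvPolynomial.C 2 * Polynomial.aeval Tm Q₀ ^ 2, hBadfin.subset fun m hm ↦ ?_⟩
    by_contra hmB
    apply hm
    obtain ⟨x, y, h, rfl, hQx, z, hzL', hz⟩ := hgood m hmB
    obtain ⟨h₂, hφm⟩ := hφval h hzL' hz
    have heQ : MvPolynomial.eval ![x, y] (Polynomial.aeval Tm Q₀) = aeval (x + β₁) Q₀ :=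
      eval_aeval_X_zero_add_C Q₀ β₁ x y
    have heP : MvPolynomial.eval ![x, y] (Polynomial.aeval Tm P₀) = aeval (x + β₁) P₀ :=
      eval_aeval_X_zero_add_C P₀ β₁ x y
    have heN : MvPolynomial.eval ![x, y] (Polynomial.aeval Tm N₀) =
        aeval (x + β₁) N₀ :=
      eval_aeval_X_zero_add_C _ β₁ x y
    refine ⟨x, y, h, rfl, ?_, ?_, ?_⟩
    · rw [heQ]; exact hQx
    · simp only [map_mul, map_pow, MvPolynomial.eval_C, heQ]
      exact mul_ne_zero two_ne_zero (pow_ne_zero 2 hQx)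
    · have hx₂ : MvPolynomial.eval ![x, y] Pm / MvPolynomial.eval ![x, y] (Polynomial.aeval Tm Q₀) =
          ((algebraMap ℚ (AlgebraicClosure ℚ) c)⁻¹ ^ 2 * aeval (x + algebraMap ℚ (AlgebraicClosure ℚ) W₁.b₂ / 12) P₀ -
            algebraMap ℚ (AlgebraicClosure ℚ) W₂.b₂ / 12 * aeval (x + algebraMap ℚ (AlgebraicClosure ℚ) W₁.b₂ / 12) Q₀) /
          aeval (x + algebraMap ℚ (AlgebraicClosure ℚ) W₁.b₂ / 12) Q₀ := by
        simp only [hPm, map_sub, map_mul, MvPolynomial.eval_C, heQ, heP, hκ, hβ₁]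
      have hy₂ : MvPolynomial.eval ![x, y]
            (MvPolynomial.C (κ ^ 3) * Polynomial.aeval Tm N₀ *
              (MvPolynomial.C 2 * MvPolynomial.X 1 + MvPolynomial.C (algebraMap ℚ (AlgebraicClosure ℚ) W₁.a₁) *
                MvPolynomial.X 0 + MvPolynomial.C (algebraMap ℚ (AlgebraicClosure ℚ) W₁.a₃)) -
            MvPolynomial.C (algebraMap ℚ (AlgebraicClosure ℚ) W₂.a₁) * Pm * Polynomial.aeval Tm Q₀ -
            MvPolynomial.C (algebraMap ℚ (AlgebraicClosure ℚ) W₂.a₃) * Polynomial.aeval Tm Q₀ ^ 2) /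
          MvPolynomial.eval ![x, y] (MvPolynomial.C 2 * Polynomial.aeval Tm Q₀ ^ 2) =
          ((algebraMap ℚ (AlgebraicClosure ℚ) c)⁻¹ ^ 3 *
              aeval (x + algebraMap ℚ (AlgebraicClosure ℚ) W₁.b₂ / 12) N₀ *
              (2 * y + algebraMap ℚ (AlgebraicClosure ℚ) W₁.a₁ * x + algebraMap ℚ (AlgebraicClosure ℚ) W₁.a₃) -
            algebraMap ℚ (AlgebraicClosure ℚ) W₂.a₁ *
              ((algebraMap ℚ (AlgebraicClosure ℚ) c)⁻¹ ^ 2 * aeval (x + algebraMap ℚ (AlgebraicClosure ℚ) W₁.b₂ / 12) P₀ -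
                algebraMap ℚ (AlgebraicClosure ℚ) W₂.b₂ / 12 * aeval (x + algebraMap ℚ (AlgebraicClosure ℚ) W₁.b₂ / 12) Q₀) *
              aeval (x + algebraMap ℚ (AlgebraicClosure ℚ) W₁.b₂ / 12) Q₀ -
            algebraMap ℚ (AlgebraicClosure ℚ) W₂.a₃ * aeval (x + algebraMap ℚ (AlgebraicClosure ℚ) W₁.b₂ / 12) Q₀ ^ 2) /
          (2 * aeval (x + algebraMap ℚ (AlgebraicClosure ℚ) W₁.b₂ / 12) Q₀ ^ 2) := by
        simp only [hPm, map_sub, map_mul, map_add, map_pow, MvPolynomial.eval_C, MvPolynomial.eval_X,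
          heQ, heP, heN, hκ, hβ₁, Matrix.cons_val_zero, Matrix.cons_val_one]
      refine ⟨by rw [hx₂, hy₂]; exact h₂, ?_⟩
      rw [hφm]
      exact Affine.Point.some.congr_simp _ _ hx₂.symm _ _ hy₂.symm _
  -- `φ` commutes with the Galois group
  have hequiv : ∀ (τ : Field.absoluteGaloisGroup ℚ) (P : W₁.geomPoints), φ (τ • P) = τ • φ P := by
    intro τ
    -- `τ` as an algebra endomorphism of `ℚ̄`, and its action on points
    let τ' : (AlgebraicClosure ℚ) ≃ₐ[ℚ] (AlgebraicClosure ℚ) := τ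
    set τₕ : (AlgebraicClosure ℚ) →ₐ[ℚ] (AlgebraicClosure ℚ) := (τ' : (AlgebraicClosure ℚ) →ₐ[ℚ] (AlgebraicClosure ℚ)) with hτₕ
    have hτinj' : Function.Injective τₕ := fun a b hab ↦ τ'.injective hab
    have hsmul₂ : ∀ P : W₂.geomPoints, τ • P = Affine.Point.map τₕ P := fun _ ↦ rfl
    -- the two homomorphisms `P ↦ φ (τ P)` and `P ↦ τ (φ P)` agree off a finite set
    have hτinj : Function.Injective (fun P : W₁.geomPoints ↦ τ • P) := MulAction.injective τ
    have hfin : (Bad ∪ (fun P : W₁.geomPoints ↦ τ • P) ⁻¹' Bad).Finite :=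
      hBadfin.union (hBadfin.preimage hτinj.injOn)
    have heq : φ.comp (DistribSMul.toAddMonoidHom W₁.geomPoints τ) =
        (DistribSMul.toAddMonoidHom W₂.geomPoints τ).comp φ := by
      refine AddMonoidHom.eq_of_eqOn_compl_finite hfin fun P hP ↦ ?_
      simp only [Set.mem_union, Set.mem_preimage, not_or] at hP
      obtain ⟨x, y, h, rfl, -, z, hzL', hz⟩ := hgood P hP.1
      obtain ⟨x', y', h', hP', -, z', hzL'', hz'⟩ := hgood _ hP.2
      have hns : (W₁.baseChange (AlgebraicClosure ℚ)).toAffine.Nonsingular (τₕ x) (τₕ y) :=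
        (W₁.toAffine.baseChange_nonsingular hτinj' x y).mpr h
      have hτP : τ • (show W₁.geomPoints from Affine.Point.some x y h) =
          (show W₁.geomPoints from Affine.Point.some (τₕ x) (τₕ y) hns) := rfl
      rw [hτP] at hP' hz'
      obtain ⟨hx', hy'⟩ := Affine.Point.some.inj hP'
      subst hx' hy'
      obtain ⟨h₂, hφP⟩ := hφval h hzL' hz
      obtain ⟨h₂', hφP'⟩ := hφval hns hzL'' hz'
      show φ (τ • (show W₁.geomPoints from Affine.Point.some x y h)) =
        τ • φ (show W₁.geomPoints from Affine.Point.some x y h)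
      rw [hτP, hφP', hφP, hsmul₂]
      erw [Affine.Point.map_some]
      refine Affine.Point.some.congr_simp _ _ ?_ _ _ ?_ _
      · simp only [map_div₀, map_sub, map_mul, map_add, map_pow, map_inv₀, map_ofNat,
          AlgHom.commutes, ← Polynomial.aeval_algHom_apply]
      · simp only [map_div₀, map_sub, map_mul, map_add, map_pow, map_inv₀, map_ofNat,
          AlgHom.commutes, ← Polynomial.aeval_algHom_apply]
    intro P
    exact congrArg (fun g : W₁.geomPoints →+ W₂.geomPoints ↦ g P) heq
  -- the isogeny
  exact ⟨{ toAddMonoidHom := φ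
           isAlgebraic := halg
           equivariant := hequiv
           finite_ker := halg.finite_ker }⟩

end Literature.NumberTheory.EllipticCurves

end
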